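import Literature.AnabelianGeometry.SemiGraphs.TemperedReconstructionEdgeVertexProofs
import HarnessLib

/-!
# Semi-graphs of anabelioids, §3: Theorem 3.7 (iii), the LOCATED form of its second sentence

Mochizuki, *Semi-graphs of anabelioids*, Publ. RIMS **42** (2006), §3, Theorem 3.7 (iii), manuscript
pp. 40–41 [cite: MochizukiSemiAnbd2006, Thm 3.7(iii) pp.40-41]: "If a nontrivial compact subgroup of
`π₁^temp(G)` is contained in more than one verticial subgroup, then it is contained in precisely two
verticial subgroups `Π_{v₁}`, `Π_{v₂}`, where `v₁`, `v₂` are the vertices joined by some [closed]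
edge `e`; moreover, in this case, this compact subgroup is contained in [an edge-like subgroup of]
`e`."  The tree's named fact `CompactInVerticial` (TemperedVerticial.lean, FROZEN) records the edge
`e` WITHOUT locating it at `v₁`, `v₂` (audit note of abc-iut-L3-t2, 2026-08-25).  Proof-only: the
located form FOLLOWS from the typed one for graphs of anabelioids as in Cor. 3.9, via the pair lemma
`exists_verticial_pair_of_mem_edgeLikeSubgroups` (an edge-like subgroup of a closed edge lies in two
distinct verticial subgroups at the vertices of its two branches) — `compactInVerticial_located`.
Nothing here takes a side on [IUTchIII] Cor. 3.12.
-/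

open CategoryTheory Topology

namespace Literature.AnabelianGeometry.SemiGraphs

namespace ProfiniteSemiGraph

universe u

variable {ℋ : ProfiniteSemiGraph.{u}}

/-- **Theorem 3.7 (iii), located form** ([SemiAnbd] pp. 40–41: "precisely two verticial subgroups
`Π_{v₁}`, `Π_{v₂}`, where `v₁`, `v₂` are the vertices joined by some edge `e` … this compact
subgroup is contained in … `e`"), from the typed `CompactInVerticial`, Thm. 3.7 (i) and the pair
lemma: a nontrivial compact subgroup contained in two distinct verticial subgroups `H₁` (at `v₁`) and
`H₂` (at `v₂`) lies in an edge-like subgroup of an edge `e` with distinct branches `b₁`, `b₂`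
abutting to `v₁` and `v₂`. [cite: MochizukiSemiAnbd2006, Thm 3.7(iii) pp.40-41] -/
theorem compactInVerticial_located (h37i : VerticialInjective.{u}) (h37iii : CompactInVerticial.{u})
    (hℋ : Cor39Hypotheses ℋ) (c : TemperedPiChart ℋ) {C : Subgroup c.G}
    (hC : IsCompact (C : Set c.G)) (hC0 : C ≠ ⊥) {v₁ v₂ : ℋ.graph.Vertex} {H₁ H₂ : Subgroup c.G}
    (hH₁ : H₁ ∈ verticialSubgroups c v₁) (hH₂ : H₂ ∈ verticialSubgroups c v₂) (hne : H₁ ≠ H₂)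
    (hC₁ : C ≤ H₁) (hC₂ : C ≤ H₂) :
    ∃ (e : ℋ.graph.Edge) (b₁ b₂ : ℋ.graph.Branch), b₁ ≠ b₂ ∧ ℋ.graph.edgeOf b₁ = e ∧
      ℋ.graph.edgeOf b₂ = e ∧ ℋ.graph.abuts b₁ = some v₁ ∧ ℋ.graph.abuts b₂ = some v₂ ∧
      ∃ L ∈ edgeLikeSubgroups c e, C ≤ L := by
  have h37 := hℋ.thm37Hypotheses
  obtain ⟨hall, e, L, -, hL, hCL⟩ := (h37iii ℋ h37 c C hC).2 hC0 v₁ v₂ H₁ H₂ hH₁ hH₂ hne hC₁ hC₂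
  obtain ⟨b₁, b₂, hb, hb₁, hb₂, -⟩ := ℋ.graph.two_branches e
  obtain ⟨w₁, hw₁⟩ := Option.isSome_iff_exists.mp (hℋ.isGraph.abuts_isSome b₁)
  obtain ⟨w₂, hw₂⟩ := Option.isSome_iff_exists.mp (hℋ.isGraph.abuts_isSome b₂)
  obtain ⟨P₁, hP₁, P₂, hP₂, hPne, hLP₁, hLP₂⟩ :=
    exists_verticial_pair_of_mem_edgeLikeSubgroups h37i hℋ c hb hb₁ hb₂ hw₁ hw₂ hL
  rcases hall w₁ P₁ hP₁ (hCL.trans hLP₁) with rfl | rfl <;>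
    rcases hall w₂ P₂ hP₂ (hCL.trans hLP₂) with h₂ | h₂
  · exact absurd h₂.symm hPne
  · subst h₂
    exact ⟨e, b₁, b₂, hb, hb₁, hb₂, (vertex_eq_of_mem_verticialSubgroups h37 c hP₁ hH₁) ▸ hw₁,
      (vertex_eq_of_mem_verticialSubgroups h37 c hP₂ hH₂) ▸ hw₂, L, hL, hCL⟩
  · subst h₂
    exact ⟨e, b₂, b₁, hb.symm, hb₂, hb₁, (vertex_eq_of_mem_verticialSubgroups h37 c hP₂ hH₁) ▸ hw₂,
      (vertex_eq_of_mem_verticialSubgroups h37 c hP₁ hH₂) ▸ hw₁, L, hL, hCL⟩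
  · exact absurd h₂.symm hPne

end ProfiniteSemiGraph

end Literature.AnabelianGeometry.SemiGraphs
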